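import Summits.NavierStokesRegularity.FluidComputer.PalasekTowerStageLocalEnergyLipschitz
import Summits.NavierStokesRegularity.FluidComputer.PalasekTowerStageSmoothness
import Summits.NavierStokesRegularity.FluidComputer.PalasekTowerWindowFirstHitting

/-!
# REGISTER v2.3′: every registered stage decays at spatial infinity UNIFORMLY on its slab, hence
# the first hitting of every floor speed happens — the hand-over calculus holds UNCONDITIONALLY

Cell `ns-blowup`, seat `ns-blowup-fc-prover-3` (g2; prover; D-0074 GROUP C/E «BRIDGE SUPPORT»;
bears_on LADDER-NS N1, route `PalasekTowerBreakdown`, child crux items stmt-NavierStokesRegularity-19249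
`HeredityAtOne` / 19250 `HeredityFromTwo`, parent 19178 `EpisodeInduction` — supports only, nothing
claimed or closed). Assembles this seat's three files: `PalasekTowerStageSmoothness.lean` (p437029:
every stage is in Tao's class, all derivatives bounded — here: the gradient bound),
`PalasekTowerStageLocalEnergyLipschitz.lean` (no energy teleportation ⇒ uniform spatial decay for
bounded-gradient Clay flows) and `PalasekTowerWindowFirstHitting.lean` (p437386: first hitting in a
growth window GIVEN uniform decay `hdec`, and the hitting inequality there). LABEL: E–C typing (KERNEL
analysis; every statement PROVED; no `Prop` introduced; no unproved fact). WHAT THIS IS NOT: not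
Navier–Stokes evidence — necessary conditions on EVERY registered stage; no stage, host, tower or
flow is constructed or claimed to exist, and no stub of the cruxes is decided.

## What is proved (every `Stage ν R S m k` with `ν > 0`)

* `Stage.exists_radius_norm_lt` — for every level `L > 0` one ball `B̄(0, ρ)` contains the
  super-level set `{‖u‖ ≥ L}` of the WHOLE slab `[0, τ_k] × ℝ³` (the `hdec` of p437386, discharged).
* `Stage.exists_window_firstHitting_of_pos` — for `j + 1 ≤ k` and `c₂ Y_j < c₁ Y_{j+1}`: the floor
  speed `c₁ Y_{j+1}` is reached for the FIRST time at some `t⋆ ∈ (τ_j, τ_{j+1}]`, at a global argmax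
  `x⋆`, with `‖u‖ < c₁Y_{j+1}` on `[0, t⋆) × ℝ³`, `⟪u, Du·v⟫ = 0`, `0 ≤ ⟪u, ∂ₜu⟫`, and the HITTING
  INEQUALITY `ν|Du|² + ⟪u, ∇p⟫ ≤ ⟪u, f⟫ ≤ c₁c₄ Y_{j+1} Y_j` at `(t⋆, x⋆)`.
* `Stage.exists_window_firstHitting_quiet_of_pos` — quiet schedule, `1 ≤ j`: the same with
  `ν|Du|² + ⟪u, ∇p⟫ ≤ 0` (the force is already silent at `t⋆ ≥ τ_1`).
* `Stage.exists_window_firstHitting_rigid_quiet` — THE REGISTER'S FORM: rigid quiet schedule on the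
  wide-base rates (separation automatic, `Schedule.Rigid.ceiling_lt_floor_wide`), every hand-over
  `j → j+1` with `1 ≤ j`, `j + 1 ≤ k` is force-free and pressure-driven at its first-hitting instant;
  `Stage.exists_firstWindow_firstHitting_rigid` — the forced first hand-over `0 → 1`.

Reading for the cruxes (numbers of record, `TowerRates.wide`, `Rigid`, `ν = 1`): every registered
stage of level `k ≥ 2` — the hypothesis class of `HeredityFromTwo` / `ReadoutFloorsAt k` /
`AprioriCeilingAt k`, and the OUTPUT class of `HeredityAtOne` — crosses the speed `c₁Y₂ ≈ 6.1·10³`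
for the first time at an instant `t⋆ ∈ (τ₁, τ₂]` (`τ₂ − τ₁ ≈ 5.5·10⁻⁵`) at a point where the pressure
gradient accelerates the fluid against its own viscous rate: `⟪u, ∇p⟫(t⋆, x⋆) ≤ −|Du(t⋆, x⋆)|²`. A
MODEL tower can be read against this signature at each of its hand-overs. Nothing here says whether
such a stage exists.

References: S. Palasek, arXiv:2605.13827 §3.3, §4 [cite: Palasek2026ElementaryModel, §4];
L. Caffarelli, R. Kohn, L. Nirenberg, CPAM 35 (1982) §2 [cite: CaffarelliKohnNirenberg1982, §2 (2.5)];
T. Tao, Anal. PDE 6 (2013), Lemma 4.1 (i), Cor. 11.1 [cite: Tao2011, Cor. 11.1].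
-/

noncomputable section

namespace Summit.NavierStokesRegularity.FluidComputer.PalasekTowerClayBridge

open Set MeasureTheory Filter Topology Function Real
open scoped ENNReal ContDiff NNReal InnerProductSpace RealInnerProductSpace
open Laplacian
open Literature.Analysis.FluidPDE

/-! ## §6 Registered stages: uniform decay, and FIRST HITTING AT EVERY HAND-OVER — unconditional -/

namespace Stage

variable {ν : ℝ} {R : TowerRates} {S : Schedule R} {m : Margins R} {k : ℕ}

/-- **Uniform spatial decay of every registered stage** (`ν > 0`; any rates, schedule, margins,
level): for every `L > 0` the speed is `< L` outside ONE ball, at ALL times of the slab. The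
hypothesis `hdec` of `PalasekTowerWindowFirstHitting.lean`, discharged: ceiling `c₂ Y_k`
(`Stage.norm_le_ceiling_top`), gradient bound (`Stage.exists_norm_fderiv_le`), energy clause, Clay
force, and `LocalEnergy.exists_radius_norm_lt`. [folklore] -/
theorem exists_radius_norm_lt (hν : 0 < ν) (s : Stage ν R S m k) {L : ℝ} (hL : 0 < L) :
    ∃ ρ : ℝ, ∀ t ∈ Icc 0 (S.τ k), ∀ x : EuclideanSpace ℝ (Fin 3), ρ ≤ ‖x‖ → ‖s.u t x‖ < L := by
  obtain ⟨B, -, hB⟩ := s.exists_norm_fderiv_le hν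
  exact LocalEnergy.exists_radius_norm_lt hν (S.τ_pos k) s.classical S.force_smooth S.force_decay
    (fun t ht x => s.norm_le_ceiling_top ht x) hB s.exists_energy_le_coe hL

/-- **FIRST HITTING AT THE HAND-OVER `j → j+1` — unconditional** (`ν > 0`; any rates, schedule,
margins; `j + 1 ≤ k`; separation `c₂ Y_j < c₁ Y_{j+1}`): the floor speed `c₁ Y_{j+1}` is reached for
the first time at some `t⋆ ∈ (τ_j, τ_{j+1}]`, at a global argmax `x⋆`, with `‖u‖ < c₁ Y_{j+1}` on
`[0, t⋆) × ℝ³`, `⟪u, Du·v⟫ = 0`, `0 ≤ ⟪u, ∂ₜu⟫`, and the hitting inequality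
`ν |Du|² + ⟪u, ∇p⟫ ≤ ⟪u, f⟫ ≤ c₁ c₄ Y_{j+1} Y_j` at `(t⋆, x⋆)`. A necessary condition on EVERY
registered stage; no instance is claimed. [cite: Palasek2026ElementaryModel, §3.3] -/
theorem exists_window_firstHitting_of_pos (hν : 0 < ν) (s : Stage ν R S m k) {j : ℕ}
    (hj : j + 1 ≤ k) (hsep : S.c₂ * R.Y j < S.c₁ * R.Y (j + 1)) :
    ∃ t₀ ∈ Ioc (S.τ j) (S.τ (j + 1)), ∃ x₀ : EuclideanSpace ℝ (Fin 3),
      ‖s.u t₀ x₀‖ = S.c₁ * R.Y (j + 1) ∧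
      (∀ x, ‖s.u t₀ x‖ ≤ S.c₁ * R.Y (j + 1)) ∧
      (∀ t ∈ Ico 0 t₀, ∀ x, ‖s.u t x‖ < S.c₁ * R.Y (j + 1)) ∧
      (∀ v, ⟪s.u t₀ x₀, fderiv ℝ (s.u t₀) x₀ v⟫ = 0) ∧
      0 ≤ ⟪s.u t₀ x₀, timeDerivWithin (Icc 0 (S.τ k)) s.u t₀ x₀⟫ ∧
      ν * frobeniusNormSq (fderiv ℝ (s.u t₀) x₀) + ⟪s.u t₀ x₀, gradient (s.p t₀) x₀⟫ ≤
        ⟪s.u t₀ x₀, S.f t₀ x₀⟫ ∧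
      ν * frobeniusNormSq (fderiv ℝ (s.u t₀) x₀) + ⟪s.u t₀ x₀, gradient (s.p t₀) x₀⟫ ≤
        S.c₁ * S.c₄ * R.Y (j + 1) * R.Y j := by
  have hL : 0 < S.c₁ * R.Y (j + 1) := mul_pos S.c₁_pos (Real.rpow_pos_of_pos (R.N_pos _) _)
  exact s.exists_window_firstHitting hν.le hj hsep (s.exists_radius_norm_lt hν hL)

/-- **FIRST HITTING AT A SILENT HAND-OVER — unconditional** (`ν > 0`, quiet schedule, `1 ≤ j`,
`j + 1 ≤ k`, separation): at the first hitting of `c₁ Y_{j+1}` in `(τ_j, τ_{j+1}]` the force is zero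
and `ν |Du|² + ⟪u, ∇p⟫ ≤ 0` — the pressure gradient ALONE pushes the fluid through the next floor
speed. [cite: Palasek2026ElementaryModel, §4] -/
theorem exists_window_firstHitting_quiet_of_pos (hν : 0 < ν) (s : Stage ν R S m k) (hQ : S.Quiet)
    {j : ℕ} (hj1 : 1 ≤ j) (hj : j + 1 ≤ k) (hsep : S.c₂ * R.Y j < S.c₁ * R.Y (j + 1)) :
    ∃ t₀ ∈ Ioc (S.τ j) (S.τ (j + 1)), ∃ x₀ : EuclideanSpace ℝ (Fin 3),
      ‖s.u t₀ x₀‖ = S.c₁ * R.Y (j + 1) ∧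
      (∀ x, ‖s.u t₀ x‖ ≤ S.c₁ * R.Y (j + 1)) ∧
      (∀ t ∈ Ico 0 t₀, ∀ x, ‖s.u t x‖ < S.c₁ * R.Y (j + 1)) ∧
      0 ≤ ⟪s.u t₀ x₀, timeDerivWithin (Icc 0 (S.τ k)) s.u t₀ x₀⟫ ∧
      ν * frobeniusNormSq (fderiv ℝ (s.u t₀) x₀) + ⟪s.u t₀ x₀, gradient (s.p t₀) x₀⟫ ≤ 0 := by
  have hL : 0 < S.c₁ * R.Y (j + 1) := mul_pos S.c₁_pos (Real.rpow_pos_of_pos (R.N_pos _) _)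
  exact s.exists_window_firstHitting_quiet hν.le hQ hj1 hj hsep (s.exists_radius_norm_lt hν hL)

/-- **THE REGISTER'S FORM.** For a stage of a RIGID, QUIET schedule on the wide-base rates (`ν > 0`;
any margins; in particular the `routeG` stages at `ν = 1` over pinned rigid quiet schedules that the
cruxes `HeredityAtOne` / `HeredityFromTwo` / `EpisodeInductionG` quantify over), EVERY hand-over
`j → j+1` with `1 ≤ j`, `j + 1 ≤ k` is force-free and pressure-driven at its first-hitting instant:
`∃ t⋆ ∈ (τ_j, τ_{j+1}], ∃ x⋆` with `‖u(t⋆, x⋆)‖ = c₁ Y_{j+1} = max`, `‖u‖ < c₁ Y_{j+1}` before, speed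
rising into `t⋆`, and `ν |Du(t⋆, x⋆)|² + ⟪u, ∇p⟫(t⋆, x⋆) ≤ 0`. Nothing here says such a stage exists.
[cite: Palasek2026ElementaryModel, §4] -/
theorem exists_window_firstHitting_rigid_quiet {S : Schedule TowerRates.wide}
    {m : Margins TowerRates.wide} {k : ℕ} (hν : 0 < ν) (s : Stage ν TowerRates.wide S m k)
    (hR : S.Rigid) (hQ : S.Quiet) {j : ℕ} (hj1 : 1 ≤ j) (hj : j + 1 ≤ k) :
    ∃ t₀ ∈ Ioc (S.τ j) (S.τ (j + 1)), ∃ x₀ : EuclideanSpace ℝ (Fin 3),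
      ‖s.u t₀ x₀‖ = S.c₁ * TowerRates.wide.Y (j + 1) ∧
      (∀ x, ‖s.u t₀ x‖ ≤ S.c₁ * TowerRates.wide.Y (j + 1)) ∧
      (∀ t ∈ Ico 0 t₀, ∀ x, ‖s.u t x‖ < S.c₁ * TowerRates.wide.Y (j + 1)) ∧
      0 ≤ ⟪s.u t₀ x₀, timeDerivWithin (Icc 0 (S.τ k)) s.u t₀ x₀⟫ ∧
      ν * frobeniusNormSq (fderiv ℝ (s.u t₀) x₀) + ⟪s.u t₀ x₀, gradient (s.p t₀) x₀⟫ ≤ 0 :=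
  s.exists_window_firstHitting_quiet_of_pos hν hQ hj1 hj (hR.ceiling_lt_floor_wide j)

/-- **The first hand-over `0 → 1` (forced era) — unconditional**, rigid wide schedule, `1 ≤ k`: the
floor speed `c₁ Y₁` is first reached at `t⋆ ∈ (τ₀, τ₁]` at a global argmax where
`ν |Du|² + ⟪u, ∇p⟫ ≤ ⟪u, f⟫ ≤ c₁ c₄ Y₁ Y₀` (window force budget `push_small`). Complements p417307's
`first_jump` (what happens at `τ₀`) with what must happen INSIDE window `0`.
[cite: Palasek2026ElementaryModel, §3.3] -/
theorem exists_firstWindow_firstHitting_rigid {S : Schedule TowerRates.wide}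
    {m : Margins TowerRates.wide} {k : ℕ} (hν : 0 < ν) (s : Stage ν TowerRates.wide S m k)
    (hR : S.Rigid) (hk : 1 ≤ k) :
    ∃ t₀ ∈ Ioc (S.τ 0) (S.τ 1), ∃ x₀ : EuclideanSpace ℝ (Fin 3),
      ‖s.u t₀ x₀‖ = S.c₁ * TowerRates.wide.Y 1 ∧
      (∀ x, ‖s.u t₀ x‖ ≤ S.c₁ * TowerRates.wide.Y 1) ∧
      (∀ t ∈ Ico 0 t₀, ∀ x, ‖s.u t x‖ < S.c₁ * TowerRates.wide.Y 1) ∧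
      0 ≤ ⟪s.u t₀ x₀, timeDerivWithin (Icc 0 (S.τ k)) s.u t₀ x₀⟫ ∧
      ν * frobeniusNormSq (fderiv ℝ (s.u t₀) x₀) + ⟪s.u t₀ x₀, gradient (s.p t₀) x₀⟫ ≤
        ⟪s.u t₀ x₀, S.f t₀ x₀⟫ ∧
      ν * frobeniusNormSq (fderiv ℝ (s.u t₀) x₀) + ⟪s.u t₀ x₀, gradient (s.p t₀) x₀⟫ ≤
        S.c₁ * S.c₄ * TowerRates.wide.Y 1 * TowerRates.wide.Y 0 := by
  obtain ⟨t₀, ht₀, x₀, heq, hle, hstrict, -, htime, hineq, hpush⟩ :=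
    s.exists_window_firstHitting_of_pos hν (j := 0) hk (hR.ceiling_lt_floor_wide 0)
  exact ⟨t₀, ht₀, x₀, heq, hle, hstrict, htime, hineq, hpush⟩

end Stage

end Summit.NavierStokesRegularity.FluidComputer.PalasekTowerClayBridge

end
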